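import Literature.NumberTheory.LFunctions.LiouvilleSieve
import Literature.Analysis.ValidatedNumerics.MultiPrecisionInterval
import HarnessLib

/-!
# Certified evaluation of Turán's sum `T(N) = ∑_{k ≤ N} λ(k)/k` at `N = 72 204 113 780 255`: the program

Barrier catalogue `Literature/Barriers/RiemannHypothesis/`, support file for the discharge of the
named fact `Literature.Barriers.RiemannHypothesis.BFM2008_thm1_minWitness`
(`T(72 204 113 780 255) < 0`, Borwein–Ferguson–Mossinghoff 2008, Theorem 1 / §2.3:
`T(n₁) = −2.0757641…·10⁻⁹`). This module contains ONLY the executable evaluator (total functions on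
`ℕ`, `ℤ`, arrays); its specification and soundness are proved in `TuranMinWitnessSound.lean`, the
blocks are evaluated by `native_decide` in `TuranMinWitness/Run*.lean`, and the fact is assembled in
`LiouvilleSignConjecturesMinWitnessProofs.lean`.

## The formula

With `λ` Liouville, `μ` Möbius, `T(x) = ∑_{k ≤ x} λ(k)/k`, `H(x) = ∑_{m ≤ x} 1/m`,
`Q(x) = ∑_{j ≤ √x} 1/j²`, a cut `D` and `y_d = ⌊N/d⌋`, `m₀(d) = ⌊D/d⌋`,
`kmax(d) = ⌊y_d/(m₀(d)+1)⌋`: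

`T(N) = ∑_{d ≤ D} (μ(d)/d) · ( Q(y_d) − ∑_{k ≤ kmax(d)} (λ(k)/k) · (H(⌊y_d/k⌋) − H(m₀(d))) )`

(Dirichlet's hyperbola identity `∑_{m ≤ y} T(⌊y/m⌋)/m = Q(y)` from `λ * 1 = 𝟙_□`, Möbius
inversion over `d ≤ D`, and the interchange `m ↔ k`; proved in `TuranMinWitnessSound.lean`). All
arguments of `H` and all `k` are `≤ K = kmax(1) = ⌊N/(D+1)⌋ ≈ 1.8·10⁹` (`D = 40000`), and only
square-free `d` contribute.

## The evaluation

The double sum is cut, for every `d`, at `k = ⌊E₀/d⌋, W, t₁, t₂, …` (`W = ⌊√N⌋`, `E₀ = ⌊N/(W+1)⌋`,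
`t_j` multiples of the sieve segment minus one), each piece being `min`-ed with `kmax(d)`; a CELL is a
range of `d` times one such piece, and every cell is evaluated by one of three strategies, each
returning an interval (`MI`, scale `2^167`) containing the cell's exact sum:

* `cellLog`  (`dk ≤ E₀`): `H(⌊N/(dk)⌋)` from a table `hlog[e] ≈ 2^57 H(⌊N/e⌋)` built by CHAINED
  logarithms `H(a) − H(b) = log((2a+1)/(2b+1)) − ∑_{b<m≤a} c_m`, `1/(12m³) ≤ c_m ≤ 1/(12m³)+1/(60m⁵)`,
  the logs by the `artanh` series in interval arithmetic;
* `cellSmall` (`k ≤ W`): individual terms `λ(k)·⌊(h(w) − h(m₀))·2^33 / k⌋` for `k ≤ √y_d`, and for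
  `k > √y_d` runs of constant `w = ⌊y_d/k⌋` against a prefix table `tPre[k] ≈ 2^110 T(k)`;
* `cellSieve` (`k > W`): a segmented sieve for `λ` on `[sQ, (s+1)Q)` (the sieve of
  `LiouvilleSieve.lean` with primes `< 43000`), a prefix table of `λ(k)⌊2^110/k⌋` on the segment,
  and for every square-free `d` the (few) runs of constant `⌊y_d/k⌋` meeting the segment.

Tables: `htab[w] = (∑_{m ≤ w} ⌊2^90/m⌋) >>> 33` (`0 ≤ 2^57 H(w) − htab[w] < 2`), `λ` as bytes.
Hot loops use exact integer arithmetic with a-priori error constants (proved in the Sound file);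
cold paths use the interval arithmetic `MI` of `MultiPrecisionInterval.lean`. The main term
`∑_d (μ(d)/d) Q(y_d)` and the final comparison are `mainTermEncl` / `finalCheck`.

## References

* [BorweinFergusonMossinghoff2008] P. Borwein, R. Ferguson, M. J. Mossinghoff, *Sign changes in
  sums of the Liouville function*, Math. Comp. 77 (2008), 1681–1694, Thm. 1 and §2.3.
* M. Deléglise, J. Rivat, *Computing the summation of the Möbius function*, Experiment. Math. 5
  (1996), 291–295 (the `O(x^{2/3})` organisation of such sums). [folklore]
-/

open Finset ArithmeticFunction
open Literature.NumberTheory.LFunctions.LiouvilleSieve (segSieve pattern Q lamOf)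
open Literature.Analysis.ValidatedNumerics.NumericsMP

namespace Literature.Barriers.RiemannHypothesis.TuranMinWitness

/-! ## Parameters -/

/-- The parameters of an evaluation: the argument `N`, the Möbius cut `D`, the table bound `W`
(intended `⌊√N⌋`) and the cut points `t₁ < t₂ < …` of the sieve region (`t_last ≥ ⌊N/(D+1)⌋`).
[folklore] -/
structure Params where
  /-- the argument of `T` -/
  N : ℕ
  /-- the Möbius cut -/
  D : ℕ
  /-- size bound of the tables (`htab`, `λ`, `tPre` have size `W + 1`) -/
  W : ℕ
  /-- the cut points `ℓ₁ < ℓ₂ < ⋯ < E₀` of the log region (in `e = dk`; the last log piece ends at `E₀`) -/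
  logCuts : List ℕ
  /-- the cut points of the sieve region -/
  cuts : List ℕ
  /-- tolerance of the chained-log table: `0 ≤ 2^57 H(⌊N/e⌋) − hlog[e] ≤ beta` -/
  beta : ℕ
  deriving Repr

namespace Params

/-- `E₀ = ⌊N/(W+1)⌋`: `dk ≤ E₀ ↔ ⌊N/(dk)⌋ > W`. [folklore] -/
def E0 (p : Params) : ℕ := p.N / (p.W + 1)

/-- `y_d = ⌊N/d⌋`. [folklore] -/
def y (p : Params) (d : ℕ) : ℕ := p.N / d

/-- `m₀(d) = ⌊D/d⌋`. [folklore] -/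
def m0 (p : Params) (d : ℕ) : ℕ := p.D / d

/-- `kmax(d) = ⌊y_d/(m₀(d)+1)⌋`. [folklore] -/
def kmax (p : Params) (d : ℕ) : ℕ := p.y d / (p.m0 d + 1)

/-- The number of log pieces (`= logCuts.length + 1`). [folklore] -/
def nLog (p : Params) : ℕ := p.logCuts.length + 1

/-- The boundaries `ℓ₀ = 0, ℓ₁, …, ℓ_{nLog} = E₀` of the log pieces (in the variable `e = dk`). [folklore] -/
def ell (p : Params) (j : ℕ) : ℕ :=
  if j = 0 then 0 else if j ≤ p.logCuts.length then p.logCuts.getD (j - 1) 0 else p.E0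

/-- The `i`-th raw cut for `d`: `⌊ℓ₀/d⌋ = 0, ⌊ℓ₁/d⌋, …, ⌊E₀/d⌋, W, t₁, t₂, …` (and `N` beyond). [folklore] -/
def rawCut (p : Params) (i d : ℕ) : ℕ :=
  if i ≤ p.nLog then p.ell i / d
  else if i = p.nLog + 1 then p.W
  else p.cuts.getD (i - p.nLog - 2) (p.y 1)

/-- The `i`-th cut for `d`: `min (kmax d) (rawCut i d)`. [folklore] -/
def cut (p : Params) (i d : ℕ) : ℕ := min (p.kmax d) (p.rawCut i d)

end Params

/-- The parameters of the target evaluation: `N = 72 204 113 780 255`, `D = 40000`,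
`W = ⌊√N⌋ = 8 497 300`, log pieces cut at `E₀/4, E₀/2, 3E₀/4` (`E₀ = 8 497 299`), sieve cuts at the
segments `60, 170, 280, …, 1710` (segment length `Q = 1 058 400`; `1710·Q > ⌊N/(D+1)⌋`, `≤ 43000²`).
[folklore] -/
def bfm : Params where
  N := 72204113780255
  D := 40000
  W := 8497300
  logCuts := [2124324, 4248649, 6372974]
  cuts := (List.range 16).map fun j => (60 + 110 * j) * 1058400 - 1
  beta := 250

/-! ## Fixed-point scales -/

/-- Scale of the harmonic tables: `htab[w] ≈ 2^57 H(w)`. [folklore] -/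
def SH : ℕ := 57
/-- Extra shift of the individual terms: accumulators at scale `2^(57+33) = 2^90`. [folklore] -/
def SI : ℕ := 33
/-- Scale of the `T`-prefix tables: `tPre[k] ≈ 2^110 T(k)`. [folklore] -/
def ST : ℕ := 110
/-- Scale of the cell results and of the run accumulators: `2^167 = 2^(110+57)`. [folklore] -/
def SR : ℕ := 167
/-- Scale of the interval arithmetic used for logarithms and the main term: `2^90`. [folklore] -/
def SL : ℕ := 2 ^ 90

/-! ## The sieve for `λ` (primes `< 43000`, arguments `< 43000²`) -/

/-- The sieving bound: primes `p < 43000` are sieved. [folklore] -/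
def P : ℕ := 43000

/-- The primes below `P`, by trial division. [folklore] -/
def primesList : List ℕ := (List.range P).filter Nat.Prime

/-- The sieved segments `0, 1, …, ⌊W/Q⌋` (each an array of `Q` sieve values). [folklore] -/
def segments (pat : Array ℤ) (W : ℕ) : Array (Array ℤ) :=
  (Array.range (W / Q + 1)).map fun s => segSieve primesList (s * Q) pat

/-- The table of `λ`-bits of `k ≤ W` (`true ↔ λ(k) = 1`; entry `0` is junk): entry `k` is read off
segment `⌊k/Q⌋` at index `k mod Q`. [folklore] -/
def lamBits (pat : Array ℤ) (W : ℕ) : Array Bool :=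
  let segs := segments pat W
  Array.ofFn (n := W + 1) fun k => decide (lamOf k.val ((segs[k.val / Q]!)[k.val % Q]!) = 1)

/-- `λ(k)` read from the bit table (`±1`). [folklore] -/
@[inline] def lamOfBit (b : Array Bool) (k : ℕ) : ℤ := if b[k]! then 1 else -1

/-! ## Prefix-sum tables -/

/-- Prefix sums: from `(m, acc, a)` push `acc + g m, acc + g m + g (m+1), …` (`fuel` entries). [folklore] -/
def prefixSumsAux {α : Type} [Add α] (g : ℕ → α) : ℕ → ℕ → α → Array α → Array α
  | 0, _, _, a => a
  | fuel + 1, m, acc, a =>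
    let acc' := acc + g m
    prefixSumsAux g fuel (m + 1) acc' (a.push acc')

/-- `prefixSums g n = #[0, g 1, g 1 + g 2, …, g 1 + ⋯ + g n]` (size `n + 1`). [folklore] -/
def prefixSums {α : Type} [Zero α] [Add α] (g : ℕ → α) (n : ℕ) : Array α :=
  prefixSumsAux g n 1 0 (((Array.mkEmpty (n + 1)).push 0))

/-- The harmonic table `htab[w] = (∑_{m ≤ w} ⌊2^90/m⌋) >>> 33 ≈ 2^57 H(w)`, `w ≤ W`
(`htab[0] = 0`). [folklore] -/
def htab (W : ℕ) : Array ℕ :=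
  (prefixSums (fun m => 2 ^ (SH + SI) / m) W).map fun a => a >>> SI

/-- The prefix table `tPre[k] = ∑_{j ≤ k} λ(j) ⌊2^110/j⌋ ≈ 2^110 T(k)`, `k ≤ W` (`tPre[0] = 0`).
[folklore] -/
def tPre (lam : Array Bool) (W : ℕ) : Array ℤ :=
  prefixSums (fun k => lamOfBit lam k * ((2 ^ ST / k : ℕ) : ℤ)) W

/-- Prefix sums on a sieved segment `e` starting at `lo`: `t[i] = ∑_{j < i} λ(lo+j) ⌊2^110/(lo+j)⌋`
(size `e.size + 1`), `λ` read off the sieve values by `lamOf`. [folklore] -/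
def tSeg (e : Array ℤ) (lo : ℕ) : Array ℤ :=
  prefixSums (fun i => lamOf (lo + i - 1) e[i - 1]! * ((2 ^ ST / (lo + i - 1) : ℕ) : ℤ)) e.size

/-! ## Hot loops of the small region -/

/-- Individual terms: for `k' = k+1, …, kb` the term `⌊(h[⌊y/k'⌋] − hm)·2^33 / k'⌋` is added to
`accP` if `λ(k') = 1` and to `accN` otherwise (so `accP − accN` accumulates `λ(k')·term`). [folklore] -/
def indivLoop (y hm : ℕ) (h : Array ℕ) (lam : Array Bool) (k kb : ℕ) (accP accN : ℕ) : ℕ × ℕ :=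
  if k < kb then
    let k' := k + 1
    let t := ((h[y / k']! - hm) <<< SI) / k'
    if lam[k']! then indivLoop y hm h lam k' kb (accP + t) accN
    else indivLoop y hm h lam k' kb accP (accN + t)
  else (accP, accN)
termination_by kb - k

/-- Runs of constant quotient: for `w' = w+1, …, wb` the run `k ∈ (max A ⌊y/(w'+1)⌋, min B ⌊y/w'⌋]`
(on which `⌊y/k⌋ = w'`) contributes `(h[w'] − hm) · (t[kHi+1−lo] − t[kLo+1−lo])`, where `t` is a
prefix table of `λ(k)⌊2^110/k⌋` for the segment starting at `lo` (`t[i]` = sum over `lo ≤ k < lo+i`).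
[folklore] -/
def runsLoop (y hm lo A B : ℕ) (h : Array ℕ) (t : Array ℤ) (w wb : ℕ) (acc : ℤ) : ℤ :=
  if w < wb then
    let w' := w + 1
    let kLo := max A (y / (w' + 1))
    let kHi := min B (y / w')
    let acc' :=
      if kLo < kHi then
        let g := h[w']! - hm
        acc + (g : ℤ) * (t[kHi + 1 - lo]! - t[kLo + 1 - lo]!)
      else acc
    runsLoop y hm lo A B h t w' wb acc'
  else acc
termination_by wb - w

/-! ## Cells of the small region (`k ≤ W`, cut index `nLog`) -/

/-- The exact-arithmetic value (scale `2^167`) of the small cell of one `d`: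
terms `k ∈ (c₁, c₂]`, `c₁ = cut nLog d = min kmax ⌊E₀/d⌋`, `c₂ = cut (nLog+1) d = min kmax W`, by individual terms for `k ≤ ks ≈ √y_d` and by
runs of constant `w = ⌊y_d/k⌋ ∈ [⌊y_d/c₂⌋, ⌊y_d/(ks+1)⌋]` for `k ∈ (ks, c₂]` (prefix table `tp`,
`lo = 1`). [folklore] -/
def smallD (p : Params) (h : Array ℕ) (lam : Array Bool) (tp : Array ℤ) (d : ℕ) : ℤ :=
  let y := p.y d
  let hm := h[p.m0 d]!
  let c1 := p.cut p.nLog d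
  let c2 := p.cut (p.nLog + 1) d
  if c2 ≤ c1 then 0 else
  let ks := min c2 (max c1 (Nat.sqrt y))
  let a := indivLoop y hm h lam c1 ks 0 0
  let r := if ks < c2 then runsLoop y hm 1 ks c2 h tp (y / c2 - 1) (y / (ks + 1)) 0 else 0
  ((a.1 : ℤ) - a.2) * 2 ^ (SR - SH - SI) + r

/-- Error allowance (scale `2^167`) of `smallD` for one `d`: `2^120`. (Valid when `W < 2^33` and
`H(W) < 17`, which the callers check: the individual terms are off by `< 1 + 2^34/k` each at scale
`2^90`, in all `< 2^77 (W + 17·2^34) < 2^115.2`; the runs by `< 2^61.1 · (run length) + 2^111 ∑_run 1/k`,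
in all `< 2^115.1`.) [folklore] -/
def smallErr : ℕ := 2 ^ 120

/-- Loop over `d ∈ (d, dHi]` accumulating `μ(d) · smallD / d` as an interval at scale `2^167`. [folklore] -/
def cellSmallLoop (p : Params) (h : Array ℕ) (lam : Array Bool) (tp : Array ℤ) (err : ℕ)
    (d dHi : ℕ) (acc : MI) : MI :=
  if d < dHi then
    let d' := d + 1
    let mu := ArithmeticFunction.moebius d'
    if mu = 0 then cellSmallLoop p h lam tp err d' dHi acc else
    let v := smallD p h lam tp d'
    let I : MI := ⟨v - err, v + err⟩
    cellSmallLoop p h lam tp err d' dHi (acc.add ((I.mulInt mu).divNat d'))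
  else acc
termination_by dHi - d

/-- **Small cell** `(dLo, dHi] × (cut nLog, cut (nLog+1)]`: an interval at scale `2^167` containing
`2^167 · ∑_{dLo < d ≤ dHi} ∑_{cut nLog d < k ≤ cut (nLog+1) d} (μ(d)/d)(λ(k)/k)(H(⌊y_d/k⌋) − H(m₀(d)))`.
[folklore] -/
def cellSmall (p : Params) (dLo dHi : ℕ) : Option MI :=
  let pat := pattern Q
  if (p.W + Q > P ^ 2) ∨ (p.N ≥ (p.W + 1) ^ 2) ∨ p.D > p.W ∨ p.W = 0 ∨ p.W ≥ 2 ^ 32 then none else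
  let h := htab p.W
  -- `H(W) < 17` (so that the error constants apply)
  if h[p.W]! + 2 > 17 * 2 ^ SH then none else
  let lam := lamBits pat p.W
  let tp := tPre lam p.W
  some (cellSmallLoop p h lam tp smallErr dLo dHi ⟨0, 0⟩)

/-! ## Cells of the sieve region (`k > W`, cut index `i ≥ nLog + 1`) -/

/-- The contribution of all square-free `d ∈ (d, D]` on the segment `[lo, lo+Q)` clipped to the cut
piece `(tLo, tHi]` and to `kmax(d)`: for each such `d` the runs `w' ∈ [⌊y_d/B⌋, ⌊y_d/(A+1)⌋]` are
evaluated exactly (scale `2^167`), given the error allowance `16·((#runs)·2^83 + 2^111·Q/max(lo, W+1) + 1)`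
(the runs are off by `< 2^61.1·(run length) + 2^111 ∑_run 1/k`, i.e. `< 2^81.2 + 2^111 Q/lo` in all), and
`μ(d)/d` times the resulting interval is added to the accumulator. [folklore] -/
def segDLoop (p : Params) (h : Array ℕ) (t : Array ℤ) (lo tLo tHi : ℕ) (d : ℕ) (acc : MI) : MI :=
  if d < p.D then
    let d' := d + 1
    let mu := ArithmeticFunction.moebius d'
    if mu = 0 then segDLoop p h t lo tLo tHi d' acc else
    let y := p.y d'
    let hm := h[p.m0 d']!
    let A := max tLo (lo - 1)
    let B := min (min tHi (p.kmax d')) (lo + Q - 1)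
    if B ≤ A then segDLoop p h t lo tLo tHi d' acc else
    let wa := y / B - 1
    let wb := y / (A + 1)
    let v := runsLoop y hm lo A B h t wa wb 0
    let e : ℕ := ((wb - wa) * 2 ^ 83 + 2 ^ 111 * Q / (max lo (p.W + 1)) + 1) * 16
    let I : MI := ⟨v - e, v + e⟩
    segDLoop p h t lo tLo tHi d' (acc.add ((I.mulInt mu).divNat d'))
  else acc
termination_by p.D - d

/-- Loop over the segments `s, s+1, … < sEnd` of a sieve cell (interval accumulator, scale `2^167`).
[folklore] -/
def cellSieveLoop (p : Params) (pat : Array ℤ) (h : Array ℕ) (tLo tHi : ℕ) (s sEnd : ℕ)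
    (acc : MI) : MI :=
  if s < sEnd then
    let lo := s * Q
    let e := segSieve primesList lo pat
    let t := tSeg e lo
    cellSieveLoop p pat h tLo tHi (s + 1) sEnd (segDLoop p h t lo tLo tHi 0 acc)
  else acc
termination_by sEnd - s

/-- **Sieve cell** with cut index `i ≥ nLog + 1`: all `d ≤ D`, `k ∈ (cut i d, cut (i+1) d]`, i.e. the piece
`(tLo, tHi] = (rawCut i, rawCut (i+1)]` clipped by `kmax(d)`; segments from `⌊(tLo+1)/Q⌋` to
`⌊tHi/Q⌋`. Returns an interval at scale `2^167`. [folklore] -/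
def cellSieve (p : Params) (i : ℕ) : Option MI :=
  let tLo := p.rawCut i 1
  let tHi := p.rawCut (i + 1) 1
  if i ≤ p.nLog ∨ tLo < p.W ∨ (p.N ≥ (p.W + 1) ^ 2) ∨ p.D > p.W ∨ p.W = 0 ∨ p.W ≥ 2 ^ 32 then none else
  if tHi ≤ tLo ∨ p.kmax 1 ≤ tLo then some ⟨0, 0⟩ else
  let sLo := (tLo + 1) / Q
  let sEnd := tHi / Q + 1
  if sEnd * Q > P ^ 2 ∨ sLo = 0 then none else
  let h := htab p.W
  if h[p.W]! + 2 > 17 * 2 ^ SH then none else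
  let pat := pattern Q
  some (cellSieveLoop p pat h tLo tHi sLo sEnd ⟨0, 0⟩)

/-! ## Logarithms and the chained table `hlog[e] ≈ 2^57 H(⌊N/e⌋)` -/

/-- Partial sums of `2·artanh v = ∑ 2 v^{2j+1}/(2j+1)`: `(pow, sum, j)` with `pow ∋ v^{2j+1}`,
stops when `pow` is below one unit or the fuel is exhausted; returns `(sum, last pow)`. [folklore] -/
def atanhLoop (V2 : MI) : ℕ → ℕ → MI → MI → MI × MI
  | 0, _, pow, sum => (sum, pow)
  | fuel + 1, j, pow, sum =>
    let sum' := sum.add ((pow.divNat (2 * j + 1)).mulInt 2)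
    let pow' := pow.mul SL V2
    if pow'.absHi ≤ 1 then (sum', pow') else atanhLoop V2 fuel (j + 1) pow' sum'

/-- Enclosure (scale `2^90`) of `log((2a+1)/(2b+1))` for `b ≤ a ≤ 3b + 1` (so that
`v = (a−b)/(a+b+1) ≤ 1/2`), by `log((1+v)/(1−v)) = 2 artanh v`; `none` otherwise. [folklore] -/
def logRatio (a b : ℕ) : Option MI :=
  if b ≤ a ∧ a ≤ 3 * b + 1 then
    let V := MI.ofFrac SL ((a : ℤ) - b) (a + b + 1)
    let V2 := V.mul SL V
    let r := atanhLoop V2 80 0 V ⟨0, 0⟩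
    -- tail `≤ 2 v^{2J+1} / (1 − v²) ≤ (8/3) v^{2J+1}`: widen by `3 · pow.hi` (upwards only would do)
    some (r.1.widen (3 * max r.2.hi 0))
  else none

/-- Enclosure (scale `2^90`) of the correction `∑_{b < m ≤ a} c_m`,
`c_m = log((2m+1)/(2m−1)) − 1/m ∈ [1/(12m³), 1/(12m³) + 1/(60m⁵)]`, using
`∑_{b<m≤a} m⁻³ ∈ [((b+1)⁻² − (a+1)⁻²)/2, (b⁻² − a⁻²)/2]` and `∑_{m>b} m⁻⁵ ≤ b⁻⁴/4`:
the interval `[((b+1)⁻² − (a+1)⁻²)/24, (b⁻² − a⁻²)/24 + b⁻⁴/240]` (for `1 ≤ b ≤ a`). [folklore] -/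
def corrEncl (a b : ℕ) : MI :=
  let lo := (MI.ofFrac SL 1 ((b + 1) ^ 2)).lo / 24 - Literature.Analysis.ValidatedNumerics.Numerics.cdiv (MI.ofFrac SL 1 ((a + 1) ^ 2)).hi 24
  let hi := Literature.Analysis.ValidatedNumerics.Numerics.cdiv (MI.ofFrac SL 1 (b ^ 2)).hi 24 - (MI.ofFrac SL 1 (a ^ 2)).lo / 24 +
    Literature.Analysis.ValidatedNumerics.Numerics.cdiv (MI.ofFrac SL 1 (b ^ 4)).hi 240
  ⟨lo, hi⟩

/-- `∑_{m ≤ W} 1/m` in interval arithmetic at scale `2^90`. [folklore] -/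
def harmonicMI (W : ℕ) : ℕ → ℕ → MI → MI
  | 0, _, acc => acc
  | fuel + 1, m, acc => if m ≤ W then harmonicMI W fuel (m + 1) (acc.add (MI.ofFrac SL 1 m)) else acc

/-- The chain: from an enclosure `cur ∋ H(b)` (`b` the previous argument) down the arguments
`a_e = ⌊N/e⌋`, `e = e, e−1, …` (`fuel` of them), prepending `⌊(lower end of 2^90 H(a_e))/2^33⌋`;
`none` if an enclosure is too wide (`≥ β·2^33`) or negative, or a log fails. [folklore] -/
def hlogChain (N β : ℕ) : ℕ → ℕ → ℕ → MI → List ℕ → Option (List ℕ)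
  | 0, _, _, _, l => some l
  | fuel + 1, e, b, cur, l =>
    let a := N / e
    match logRatio a b with
    | none => none
    | some L =>
      let cur' := (cur.add L).sub (corrEncl a b)
      if cur'.hi - cur'.lo ≥ β * 2 ^ SI ∨ cur'.lo < 0 then none else
      hlogChain N β fuel (e - 1) a cur' ((cur'.lo.toNat) >>> SI :: l)

/-- The table `hlog[e] ≈ 2^57 H(⌊N/e⌋)` for `eLo < e ≤ eHi` (entries `≤ eLo` junk `0`), anchored at
`H(⌊N/(eHi+1)⌋)` computed by summation. [folklore] -/
def hlogTab (p : Params) (eLo eHi : ℕ) : Option (Array ℕ) :=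
  let b₀ := p.N / (eHi + 1)
  if b₀ = 0 ∨ eHi < eLo then none else
  let hb := harmonicMI b₀ b₀ 1 ⟨0, 0⟩
  match hlogChain p.N p.beta (eHi - eLo) eHi b₀ hb [] with
  | none => none
  | some l => some (List.replicate (eLo + 1) 0 ++ l).toArray

/-! ## Cells of the log region (cut indices `i < nLog`: `ℓ_i < dk ≤ ℓ_{i+1}`) -/

/-- Individual terms with the log table: `acc + ∑_{k < k' ≤ kb} λ(k') ⌊(hlog[d k'] − hm)·2^33/k'⌋`
(the difference may in principle be negative: `ℤ` arithmetic, floor division). [folklore] -/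
def logLoop (d : ℕ) (hm : ℤ) (hl : Array ℕ) (lam : Array Bool) (k kb : ℕ) (acc : ℤ) : ℤ :=
  if k < kb then
    let k' := k + 1
    let t : ℤ := (((hl[d * k']! : ℤ) - hm) * 2 ^ SI) / (k' : ℤ)
    logLoop d hm hl lam k' kb (if lam[k']! then acc + t else acc - t)
  else acc
termination_by kb - k

/-- Error allowance (scale `2^167`) of a log piece for one `d`: `2^115 (β + 2)`. (Valid when
`W < 2^33` and `H(W) < 17`: each term is off by `< 1 + 2^33 (β + 1)/k` at scale `2^90`, in all
`< W + 2^33 (β+1)·17 < 2^38 (β + 2)`.) [folklore] -/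
def logErr (β : ℕ) : ℕ := 2 ^ 115 * (β + 2)

/-- Loop over `d ∈ (d, D]` for the log cell `i`: terms `k ∈ (cut i d, cut (i+1) d]`. [folklore] -/
def cellLogLoop (p : Params) (i : ℕ) (h : Array ℕ) (hl : Array ℕ) (lam : Array Bool) (err : ℕ)
    (d : ℕ) (acc : MI) : MI :=
  if d < p.D then
    let d' := d + 1
    let mu := ArithmeticFunction.moebius d'
    if mu = 0 then cellLogLoop p i h hl lam err d' acc else
    let v := logLoop d' (h[p.m0 d']! : ℤ) hl lam (p.cut i d') (p.cut (i + 1) d') 0 * 2 ^ (SR - SH - SI)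
    let I : MI := ⟨v - err, v + err⟩
    cellLogLoop p i h hl lam err d' (acc.add ((I.mulInt mu).divNat d'))
  else acc
termination_by p.D - d

/-- **Log cell** `i < nLog`: all `d ≤ D`, `k ∈ (cut i d, cut (i+1) d]` (`ℓ_i < dk ≤ ℓ_{i+1}`); an
interval at scale `2^167`. [folklore] -/
def cellLog (p : Params) (i : ℕ) : Option MI :=
  let pat := pattern Q
  if (p.W + Q > P ^ 2) ∨ (p.N ≥ (p.W + 1) ^ 2) ∨ p.D > p.W ∨ p.W = 0 ∨ p.W ≥ 2 ^ 32 ∨ p.E0 > p.W ∨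
    p.nLog ≤ i ∨ p.ell (i + 1) > p.E0 then none else
  let h := htab p.W
  if h[p.W]! + 2 > 17 * 2 ^ SH then none else
  match hlogTab p (p.ell i) (p.ell (i + 1)) with
  | none => none
  | some hl =>
    if hl.size ≠ p.ell (i + 1) + 1 then none else
    let lam := lamBits pat p.W
    some (cellLogLoop p i h hl lam (logErr p.beta) 0 ⟨0, 0⟩)

/-! ## Cells in general, the main term, the final check -/

/-- The cell `(dLo, dHi] × (cut i, cut (i+1)]` by the strategy of its cut index: log cells
(`i < nLog`) and sieve cells (`i > nLog`) take all `d ≤ D` and must be called with `dLo = 0`,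
`dHi = D`; the small cell (`i = nLog`) takes the `d`-range. [folklore] -/
def cell (p : Params) (i dLo dHi : ℕ) : Option MI :=
  if i < p.nLog then (if dLo = 0 ∧ dHi = p.D then cellLog p i else none)
  else if i = p.nLog then cellSmall p dLo dHi
  else (if dLo = 0 ∧ dHi = p.D then cellSieve p i else none)

/-- `cellCheck p i dLo dHi L = true` iff the cell evaluates to an interval with lower end `≥ L`.
[folklore] -/
def cellCheck (p : Params) (i dLo dHi : ℕ) (L : ℤ) : Bool :=
  match cell p i dLo dHi with
  | some I => decide (L ≤ I.lo)
  | none => false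

/-- `∑_{j ≤ J} ⌊2^110/j²⌋` advanced from `(j, acc)` to `J`. [folklore] -/
def qAdvance (J : ℕ) : ℕ → ℕ → ℕ → ℕ × ℕ
  | 0, j, acc => (j, acc)
  | fuel + 1, j, acc =>
    if j < J then qAdvance J fuel (j + 1) (acc + 2 ^ ST / ((j + 1) * (j + 1))) else (j, acc)

/-- The main term `∑_{d ≤ D} (μ(d)/d) Q(y_d)` at scale `2^110`, `d` from `d` down to `1`
(`Q(y_d)` read off the running prefix sum of `1/j²` at `J_d = ⌊√y_d⌋`, nondecreasing). [folklore] -/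
def mainTermLoop (p : Params) : ℕ → ℕ → ℕ → MI → MI
  | 0, _, _, acc => acc
  | d + 1, j, q, acc =>
    let J := Nat.sqrt (p.y (d + 1))
    let r := qAdvance J (J - j) j q
    let mu := ArithmeticFunction.moebius (d + 1)
    let I : MI := ⟨(r.2 : ℤ), (r.2 : ℤ) + J⟩
    mainTermLoop p d r.1 r.2 (acc.add ((I.mulInt mu).divNat (d + 1)))

/-- Enclosure of the main term `∑_{d ≤ D} (μ(d)/d) Q(⌊N/d⌋)` at scale `2^110`. [folklore] -/
def mainTermEncl (p : Params) : MI := mainTermLoop p p.D 0 0 ⟨0, 0⟩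

/-- **The final comparison.** `finalCheck p Ls = true` iff `2^57 · (main term).hi < ∑ Ls`; with
`Ls` certified lower bounds (scale `2^167`) of cells tiling the double sum this gives `T(N) < 0`.
[folklore] -/
def finalCheck (p : Params) (Ls : List ℤ) : Bool :=
  decide ((mainTermEncl p).hi * 2 ^ (SR - ST) < Ls.sum)

end Literature.Barriers.RiemannHypothesis.TuranMinWitness
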